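import Mathlib.Analysis.InnerProductSpace.LinearPMap
import Mathlib.Analysis.InnerProductSpace.Positive
import Mathlib.Analysis.InnerProductSpace.Spectrum
import Mathlib.Analysis.InnerProductSpace.Adjoint
import Mathlib.Algebra.Algebra.Spectrum.Basic
import Mathlib.Analysis.SpecialFunctions.Exp
import Literature.Analysis.UnboundedOperators.SymmetricPMap
import HarnessLib

-- provenance: harness21/H21/H21/Prelude/UnbddOp/SpectralGap.lean @ 7fd1621 (interim HEAD d8f2665); M5 mechanical rewrite
/-!
# Spectral gap above the ground state

Trunk: UnbddOp (prelude item C2 `SpectralGap`; notion `spectral_gap_unbounded`, used by the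
constructive-QFT mass-gap and Hubbard gap statements).

We formalise "the Hamiltonian `H ≥ 0` has a unique ground state `Ω` and a gap `Δ > 0` above it"
at three levels:

* **form level** for a partially defined operator `A : E →ₗ.[𝕜] E` (no completeness needed):
  `LinearPMap.HasFormGap A Ω Δ` — `A ≥ 0`, `A Ω = 0`, and `A ≥ Δ` in the form sense on
  `dom A ∩ {Ω}ᗮ`; degenerate version `LinearPMap.HasFormGapAbove A V E₀ Δ` with a ground
  eigenspace `V` at energy `E₀`;
* **operator level** (`[CompleteSpace E]`): `LinearPMap.HasGroundStateGap`,
  `LinearPMap.HasSpectralGapAbove` add `IsSelfAdjoint A`; by the min–max principle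
  (Reed–Simon IV, Theorem XIII.1) this is the usual spectral statement
  `σ(H) ∖ {E₀} ⊆ [E₀ + Δ, ∞)`;
* **bounded operators** `T : E →L[𝕜] E`: `ContinuousLinearMap.groundEnergy`,
  `ContinuousLinearMap.spectralGap`, `ContinuousLinearMap.HasSpectralGap` phrased with Mathlib's
  `spectrum 𝕜 T`, and the transfer-matrix form `ContinuousLinearMap.HasTransferGap`
  (`T = e^{-H}`, gap `m` means `T ≤ e^{-m}` on `{Ω}ᗮ`; Glimm–Jaffe, *Quantum Physics*, §6.1).
  Only `HasSpectralGap` (which mentions `IsSelfAdjoint T`, i.e. the adjoint) needs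
  `[CompleteSpace E]`.

Sources: Reed–Simon, *Methods of Modern Mathematical Physics IV*, §XIII.1 (min–max) and
§XIII.12 (non-degenerate ground states) [ReedSimonIV1978]; Reed–Simon I, §VII.3
[ReedSimonI1980]; Glimm–Jaffe, *Quantum Physics*, §6.1, §19 [GlimmJaffeQP1987].
Finite-dimensional sanity check against Mathlib's `LinearMap.IsSymmetric.eigenvalues`
(which are *antitone*, `LinearMap.IsSymmetric.eigenvalues_antitone`: the ground energy is the
*last* eigenvalue).

## Mathlib

Used without redefinition: `spectrum 𝕜 T`, `IsSelfAdjoint`, `ContinuousLinearMap.IsPositive`,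
`Module.End.eigenspace`, `LinearMap.IsSymmetric.eigenvalues`, `LinearMap.toContinuousLinearMap`,
`LinearMap.toPMap`, `Submodule.span` (`𝕜 ∙ Ω`) and `Submodule.orthogonal` (`Kᗮ`), plus the H21
prelude `LinearPMap.IsPositive`, `IsBoundedBelowOn`, `infRayleighOn`, `eigenspace`, `kernel`.
Mathlib has no spectral gap / ground energy vocabulary (searched `spectralGap`, `groundEnergy`,
`groundState`).

## Design choices

* All declarations are deliberate dot-notation extensions in the Mathlib namespaces
  `LinearPMap`, `ContinuousLinearMap`, `LinearMap.IsSymmetric`; each docstring says so.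
* `groundEnergy`/`spectralGap` are real `sInf`s and carry documented junk values; the predicate
  `HasSpectralGap` avoids them by its `finrank = 1` conjunct (which forces `E₀ ∈ σ(T)`).
* Real parts `re '' spectrum 𝕜 T` are used so that the definitions make sense uniformly over
  `RCLike 𝕜`; for self-adjoint `T` the spectrum is real anyway.
-/

noncomputable section

open RCLike

open scoped InnerProductSpace

variable {𝕜 E : Type*} [RCLike 𝕜] [NormedAddCommGroup E] [InnerProductSpace 𝕜 E]

local notation "⟪" x ", " y "⟫" => inner 𝕜 x y

namespace LinearPMap

/-! ### Form-level gap for partially defined operators -/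

section Form

/-- (Dot-notation extension of Mathlib's `LinearPMap`.) `A.HasFormGap Ω Δ`: the partially
defined operator `A` is positive, `Ω ≠ 0` lies in `dom A` with `A Ω = 0` (a ground state at
energy `0`), `0 < Δ`, and `A ≥ Δ` in the form sense on `dom A ∩ {Ω}ᗮ`
(`Δ ‖x‖² ≤ re ⟪x, A x⟫` for `x ⊥ Ω`). This is the quadratic-form version of
"unique ground state with gap `Δ`" (Reed–Simon IV, §XIII.1 and §XIII.12; Glimm–Jaffe,
*Quantum Physics*, §6.1). No completeness of `E` is required. [folklore] -/
def HasFormGap (A : E →ₗ.[𝕜] E) (Ω : E) (Δ : ℝ) : Prop :=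
  A.IsPositive ∧ Ω ≠ 0 ∧ (∃ h : Ω ∈ A.domain, A ⟨Ω, h⟩ = 0) ∧ 0 < Δ ∧
    A.IsBoundedBelowOn (𝕜 ∙ Ω)ᗮ Δ

/-- (Dot-notation extension of Mathlib's `LinearPMap`.) Degenerate form-level gap:
`A.HasFormGapAbove V E₀ Δ` says that `A` is symmetric with `A ≥ E₀`, the non-trivial submodule
`V` consists of eigenvectors for the ground energy `E₀`, `0 < Δ`, and `A ≥ E₀ + Δ` in the form
sense on `dom A ∩ Vᗮ` (Reed–Simon IV, §XIII.1; this is the shape of the Hubbard-model gap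
statements, where the ground state may be degenerate). [folklore] -/
def HasFormGapAbove (A : E →ₗ.[𝕜] E) (V : Submodule 𝕜 E) (E₀ Δ : ℝ) : Prop :=
  A.IsSymmetric ∧ A.IsBoundedBelowOn ⊤ E₀ ∧ V ≠ ⊥ ∧ V ≤ A.eigenspace (E₀ : 𝕜) ∧ 0 < Δ ∧
    A.IsBoundedBelowOn Vᗮ (E₀ + Δ)

/-- (Dot-notation extension of Mathlib's `LinearPMap`.) The best form gap above the ground state
`Ω`: the infimum of the Rayleigh quotient of `A` on `dom A ∩ {Ω}ᗮ` (min–max, Reed–Simon IV,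
Theorem XIII.1). Inherits the junk value `0` of `LinearPMap.infRayleighOn` (empty index or
unbounded below); use under `HasFormGap`. [folklore] -/
def groundStateGap (A : E →ₗ.[𝕜] E) (Ω : E) : ℝ :=
  A.infRayleighOn (𝕜 ∙ Ω)ᗮ

/-- Under a form gap the ground state is simple: the kernel of `A` is exactly the line `𝕜 ∙ Ω`
(Reed–Simon IV, §XIII.12, nondegenerate ground states, with Thm. XIII.1).
[cite: ReedSimonIV1978, §XIII.12 with Thm. XIII.1] -/
def HasFormGap.kernel_eq_span : Prop :=
  ∀ {A : E →ₗ.[𝕜] E} {Ω : E} {Δ : ℝ} (h : A.HasFormGap Ω Δ),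
    A.kernel = 𝕜 ∙ Ω

/-- A form gap `Δ` may be weakened to any `0 < Δ' ≤ Δ`. [folklore] -/
theorem HasFormGap.anti {A : E →ₗ.[𝕜] E} {Ω : E} {Δ Δ' : ℝ} (h : A.HasFormGap Ω Δ)
    (hΔ' : 0 < Δ') (hle : Δ' ≤ Δ) : A.HasFormGap Ω Δ' :=
  ⟨h.1, h.2.1, h.2.2.1, hΔ', h.2.2.2.2.anti hle⟩

/-- A form gap with ground state `Ω` is a degenerate form gap above `E₀ = 0` with ground
eigenspace `V = 𝕜 ∙ Ω`. [folklore] -/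
theorem HasFormGap.hasFormGapAbove {A : E →ₗ.[𝕜] E} {Ω : E} {Δ : ℝ} (h : A.HasFormGap Ω Δ) :
    A.HasFormGapAbove (𝕜 ∙ Ω) 0 Δ := by
  obtain ⟨hpos, hΩ0, ⟨hΩd, hAΩ⟩, hΔ, hbd⟩ := h
  refine ⟨hpos.isSymmetric, ((isPositive_iff_isBoundedBelowOn_top A).mp hpos).2, ?_, ?_, hΔ,
    by simpa using hbd⟩
  · simpa [Submodule.span_singleton_eq_bot] using hΩ0
  · rw [Submodule.span_le, Set.singleton_subset_iff]
    exact mem_eigenspace_iff.mpr ⟨hΩd, by simpa using hAΩ⟩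

/-- A form gap `Δ` is at most the best gap `groundStateGap A Ω`, provided `dom A ∩ {Ω}ᗮ ≠ 0`
(otherwise `groundStateGap` is the junk value `0`; Reed–Simon IV, Theorem XIII.1). [folklore] -/
theorem HasFormGap.le_groundStateGap {A : E →ₗ.[𝕜] E} {Ω : E} {Δ : ℝ} (h : A.HasFormGap Ω Δ)
    (hne : ∃ x : A.domain, (x : E) ∈ (𝕜 ∙ Ω)ᗮ ∧ (x : E) ≠ 0) : Δ ≤ A.groundStateGap Ω :=
  le_infRayleighOn_of_isBoundedBelowOn h.2.2.2.2 hne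

end Form

/-! ### Operator-level gap (self-adjoint operators) -/

section SelfAdjoint

variable [CompleteSpace E]

/-- (Dot-notation extension of Mathlib's `LinearPMap`.) `A.HasGroundStateGap Ω Δ`: `A` is
self-adjoint (Mathlib's `IsSelfAdjoint` for `LinearPMap.instStar`) and has the form gap
`HasFormGap Ω Δ`. For a self-adjoint `H` this **is** the spectral statement
"`H ≥ 0`, `H Ω = 0`, `0` is a simple eigenvalue and `σ(H) ∖ {0} ⊆ [Δ, ∞)`", by the min–max
principle (Reed–Simon IV, Theorem XIII.1; Glimm–Jaffe, *Quantum Physics*, §6.1). [folklore] -/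
def HasGroundStateGap (A : E →ₗ.[𝕜] E) (Ω : E) (Δ : ℝ) : Prop :=
  IsSelfAdjoint A ∧ A.HasFormGap Ω Δ

/-- (Dot-notation extension of Mathlib's `LinearPMap`.) `A.HasSpectralGapAbove V E₀ Δ`: `A` is
self-adjoint and has the degenerate form gap `HasFormGapAbove V E₀ Δ`; by min–max this says
`inf σ(A) = E₀`, `V` consists of ground states and `σ(A) ∖ {E₀} ⊆ [E₀ + Δ, ∞)` when moreover
`V = eigenspace E₀` (Reed–Simon IV, Theorem XIII.1). [folklore] -/
def HasSpectralGapAbove (A : E →ₗ.[𝕜] E) (V : Submodule 𝕜 E) (E₀ Δ : ℝ) : Prop :=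
  IsSelfAdjoint A ∧ A.HasFormGapAbove V E₀ Δ

/-- A ground-state gap is in particular a form gap (by definition). [folklore] -/
theorem HasGroundStateGap.hasFormGap {A : E →ₗ.[𝕜] E} {Ω : E} {Δ : ℝ}
    (h : A.HasGroundStateGap Ω Δ) : A.HasFormGap Ω Δ :=
  h.2

end SelfAdjoint

end LinearPMap

/-! ### Bounded operators: ground energy and spectral gap via the spectrum -/

namespace ContinuousLinearMap

section Spectrum

/-- (Dot-notation extension of Mathlib's `ContinuousLinearMap`.) The *ground energy*
`inf re σ(T)` of a bounded operator (Reed–Simon IV, §XIII.1).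
**Junk value**: `sInf ∅ = 0` when `spectrum 𝕜 T = ∅`, which Mathlib cannot exclude over
`𝕜 = ℝ`; also `0` if `re '' σ(T)` were unbounded below (it is not: the spectrum is bounded). [folklore] -/
def groundEnergy (T : E →L[𝕜] E) : ℝ :=
  sInf (re '' spectrum 𝕜 T)

/-- (Dot-notation extension of Mathlib's `ContinuousLinearMap`.) The *spectral gap*
`inf (re σ(T) ∖ {E₀}) - E₀` above the ground energy `E₀ = T.groundEnergy`
(Reed–Simon IV, §XIII.1). **Junk value** `-E₀` when `re '' σ(T) ⊆ {E₀}` (then the `sInf` is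
over `∅`); statements use it only under `HasSpectralGap`. [folklore] -/
def spectralGap (T : E →L[𝕜] E) : ℝ :=
  sInf ((re '' spectrum 𝕜 T) \ {T.groundEnergy}) - T.groundEnergy

/-- (Dot-notation extension of Mathlib's `ContinuousLinearMap`.) Transfer-matrix form of the
gap: for `T = e^{-H}` a positive bounded operator with `T Ω = Ω` (`Ω ≠ 0` the vacuum),
`T.HasTransferGap Ω m` says `0 < m` and `re ⟪T x, x⟫ ≤ e^{-m} ‖x‖²` for all `x ⊥ Ω`, i.e.
`H ≥ m` on `{Ω}ᗮ` (Glimm–Jaffe, *Quantum Physics*, §6.1, Theorem 6.1.3 ff.; Osterwalder–Schrader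
reconstruction). No completeness of `E` is required. [folklore] -/
def HasTransferGap (T : E →L[𝕜] E) (Ω : E) (m : ℝ) : Prop :=
  T.IsPositive ∧ Ω ≠ 0 ∧ T Ω = Ω ∧ 0 < m ∧
    ∀ x ∈ (𝕜 ∙ Ω)ᗮ, re ⟪T x, x⟫ ≤ Real.exp (-m) * ‖x‖ ^ 2

end Spectrum

section Bounded

variable [CompleteSpace E]

/-- (Dot-notation extension of Mathlib's `ContinuousLinearMap`.) `T.HasSpectralGap Δ`: `T` is
self-adjoint, `0 < Δ`, the ground energy `E₀ = T.groundEnergy` is a *simple* eigenvalue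
(`finrank (eigenspace T E₀) = 1`), and `re σ(T) ⊆ {E₀} ∪ [E₀ + Δ, ∞)`
(Reed–Simon IV, §XIII.1 and §XIII.12). The `finrank = 1` conjunct forces `E₀ ∈ σ(T)`, so
there is no empty-spectrum vacuity despite the junk value of `groundEnergy`. The predicate is
antitone in `Δ` on `(0, ∞)`. [folklore] -/
def HasSpectralGap (T : E →L[𝕜] E) (Δ : ℝ) : Prop :=
  IsSelfAdjoint T ∧ 0 < Δ ∧
    Module.finrank 𝕜 (Module.End.eigenspace (T : E →ₗ[𝕜] E) (T.groundEnergy : 𝕜)) = 1 ∧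
    re '' spectrum 𝕜 T ⊆ {T.groundEnergy} ∪ Set.Ici (T.groundEnergy + Δ)

/-- A spectral gap `Δ` may be weakened to any `0 < Δ' ≤ Δ`. [folklore] -/
theorem HasSpectralGap.anti {T : E →L[𝕜] E} {Δ Δ' : ℝ} (h : T.HasSpectralGap Δ)
    (hΔ' : 0 < Δ') (hle : Δ' ≤ Δ) : T.HasSpectralGap Δ' := by
  refine ⟨h.1, hΔ', h.2.2.1, h.2.2.2.trans (Set.union_subset_union_right _ ?_)⟩
  exact Set.Ici_subset_Ici.mpr (by linarith)

/-- Bridge between the unbounded and the bounded formulation: for a bounded self-adjoint `T`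
with ground energy `0`, and `Ω ≠ 0` with `T Ω = 0`, the `LinearPMap` `(↑T).toPMap ⊤` has a
ground-state gap `Δ` at `Ω` iff `T` has the spectral gap `Δ` (min–max principle, Reed–Simon IV,
Theorem XIII.1: `T ≥ Δ` in the form sense on `{Ω}ᗮ` iff `σ(T|{Ω}ᗮ) ⊆ [Δ, ∞)`; and `Ω ≠ 0`,
`T Ω = 0`, `finrank (eigenspace T 0) = 1` together say `eigenspace T 0 = 𝕜 ∙ Ω`).
[cite: ReedSimonIV1978, Thm. XIII.1 (min–max principle)] -/
def hasGroundStateGap_toPMap_iff : Prop :=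
  ∀ {T : E →L[𝕜] E} (hT : IsSelfAdjoint T) (h0 : T.groundEnergy = 0) {Ω : E} (hΩ0 : Ω ≠ 0) (hΩ : T Ω = 0) (Δ : ℝ),
    ((T : E →ₗ[𝕜] E).toPMap ⊤).HasGroundStateGap Ω Δ ↔ T.HasSpectralGap Δ

/-- Any `Δ` with `T.HasSpectralGap Δ` is at most the numerical spectral gap, provided the
spectrum is not reduced to the ground energy (otherwise `spectralGap` is junk). Definition
chasing on `HasSpectralGap` / `spectralGap`. [folklore] -/
def le_spectralGap_of_hasSpectralGap : Prop :=
  ∀ {T : E →L[𝕜] E} {Δ : ℝ} (h : T.HasSpectralGap Δ) (hne : ((re '' spectrum 𝕜 T) \ {T.groundEnergy}).Nonempty),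
    Δ ≤ T.spectralGap

/-- Under `HasSpectralGap Δ` the numerical spectral gap is positive (indeed `≥ Δ`, see
`le_spectralGap_of_hasSpectralGap`), provided the spectrum is not reduced to the ground energy
(guarding the junk value `-E₀` of `spectralGap`, e.g. `T = 1` on a one-dimensional space). [folklore] -/
def HasSpectralGap.spectralGap_pos : Prop :=
  ∀ {T : E →L[𝕜] E} {Δ : ℝ} (h : T.HasSpectralGap Δ) (hne : ((re '' spectrum 𝕜 T) \ {T.groundEnergy}).Nonempty),
    0 < T.spectralGap

/- interim proof relied on results that are now named facts (D-0014); demoted to a fact by the M5 import, proof preserved: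
:=
  h.2.1.trans_le (le_spectralGap_of_hasSpectralGap h hne)
-/

/-- Spectral characterisation of the transfer-matrix gap: `T.HasTransferGap Ω m` iff `T` is
self-adjoint with `re σ(T) ⊆ [0, e^{-m}] ∪ {1}`, `0 < m`, and the eigenvalue `1` is simple with
eigenvector `Ω ≠ 0` (spectral theorem for bounded self-adjoint operators; Glimm–Jaffe,
*Quantum Physics*, §6.1; Reed–Simon I, §VII.3). [cite: ReedSimonI1980, §VII.3 (spectral theorem)] -/
def hasTransferGap_iff_spectrum : Prop :=
  ∀ {T : E →L[𝕜] E} {Ω : E} {m : ℝ},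
    T.HasTransferGap Ω m ↔
      IsSelfAdjoint T ∧ Ω ≠ 0 ∧ 0 < m ∧
        re '' spectrum 𝕜 T ⊆ Set.Icc 0 (Real.exp (-m)) ∪ {1} ∧
        Module.End.eigenspace (T : E →ₗ[𝕜] E) 1 = 𝕜 ∙ Ω

end Bounded

end ContinuousLinearMap

/-! ### Finite-dimensional sanity check -/

namespace LinearMap.IsSymmetric

variable [FiniteDimensional 𝕜 E] [CompleteSpace E]

/-- (Dot-notation extension of Mathlib's `LinearMap.IsSymmetric`.) Finite-dimensional sanity
check: for a symmetric `T` on a space of dimension `n + 2`, `T` (as a continuous linear map) has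
a spectral gap `Δ` iff `0 < Δ` and the lowest eigenvalue plus `Δ` is at most the second lowest.
(The hypothesis `[CompleteSpace E]` is automatic, `FiniteDimensional.complete`, but not a
Mathlib instance since it depends on `𝕜`.)
Mathlib's `LinearMap.IsSymmetric.eigenvalues` are sorted in *decreasing* order
(`eigenvalues_antitone`), so the ground energy is the entry `Fin.last (n+1)` and the first
excited level is `Fin.castSucc (Fin.last n)` (Reed–Simon IV, §XIII.1, finite-dimensional
min–max). [cite: ReedSimonIV1978, Thm. XIII.1 (finite-dimensional min–max)] -/
def hasSpectralGap_toContinuousLinearMap_iff : Prop :=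
  ∀ {T : E →ₗ[𝕜] E} (hT : T.IsSymmetric) {n : ℕ} (hn : Module.finrank 𝕜 E = n + 2) (Δ : ℝ),
    (LinearMap.toContinuousLinearMap T).HasSpectralGap Δ ↔
      0 < Δ ∧ hT.eigenvalues hn (Fin.last (n + 1)) + Δ ≤
        hT.eigenvalues hn (Fin.castSucc (Fin.last n))

end LinearMap.IsSymmetric
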